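import Mathlib
import Literature.NumberTheory.LFunctions.Zhang2022.Section12Htilde15AFEWindow
import HarnessLib

/-!
# Zhang (2022) §12 p. 67, the approximate functional equation for `H̃₁₅` — II: the node
# `Z22:§12.u009` (`Typed.Sec12A.Htilde15ApproxFE`) in the `ε`-carrying reading, from the smoothed
# approximate functional equation of Lemma 11.2 (`Section11AFE.Step11u024e`) at `s + β₆`

Topic `Literature/NumberTheory/LFunctions/Zhang2022` (Landau–Siegel audit tree; verdict-neutral).
Y. Zhang, *Discrete mean estimates and the Landau–Siegel zero*, arXiv:2211.02515v1 (2022)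
[Zhang2022LandauSiegel] — **an unrefereed manuscript under adjudication; nothing here asserts or
denies its Theorems 1–2.** ZHANG-L lane (WP12, helper H2 under the leaf hXi `Typed.Sec12A.Xi15Hbar16`,
row G-d42-3); companion of `Section12Htilde15AFEWindow`.

The node (§12 p. 67, tex L3426–L3429): "Assume `σ = 1/2`, `|t − 2πt₀| < 𝓛₁` and `0.5 ≤ z ≤ 0.504`.
Using the proof of Lemma 11.2 with `s + β₆` in place of `s` we deduce that
`H̃₁₅(s,ψ) = (Z(s+β₆,ψχ)P₁^{β₆}/0.504) Σ_n χψ̄(n) n^{−(1−s−β₆)} ∫_{0.496}^{0.5}{g(P^{0.5}Dt₀/n) −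
g(P^zDt₀/n)}dz + O(E(s+β₆,ψ))`."  As for Lemma 11.2 itself (cell row G-d44-1: the printed error
`O(E₂)` lacks the `ε = exp{−c𝓛¹⁰}` of Lemma 6.1's `E₁`; the tree PROVES the repaired display
`Section11AFE.Step11u024e`, error `C·(E₂(s,ψ) + e^{−c𝓛¹⁰})`, `Section11AFE.step11u024e_holds`), what
is derivable is the `ε`-CARRYING reading: error `C·(E₂(s+β₆,ψ) + e^{−c𝓛¹⁰})`. «vs PRINT: the printed
display with Lemma 6.1's `+ε` in the error term, exactly as G-d44-1 repaired Lemma 11.2.»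

* `tsum_dualTerm_eq` — the dual series of the node is `−(∫_{0.496}^{0.5}G(z)dz − 0.004·G(0.5))` for the
  reflected series `G(z) = Σ_n \overline{χψ}(n)n^{−(1−s−β₆)}g(P^zDt₀/n)` (termwise integration,
  `Section11Deductions.hasSum_gTerm`; `χ` real);
* `htilde15_afe_core` — GIVEN the smoothed approximate functional equation at `s + β₆` for every
  `z ∈ [0.5, 0.504]` with error `≤ B`, the display holds with error `≤ B + e^{−𝓛¹⁰/2}`: `H̃₁₅` is
  `(P₁^{β₆}/0.504)∫_{0.5}^{0.504}` of the window sums (`Htilde15_eq_integral`), the window sums are the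
  full series up to `2e^{−𝓛¹⁰/2}` (`norm_winSum_sub_tsum_le`), the series is integrated over
  `[0.5, 0.504]` against the AFE (`Section11LeavesEps.integral_afe_le'`), `0.004×` the instance
  `z = 0.5` is subtracted (the two `L(s+β₆,χψ)` cancel), `z ↦ 1 − z` — pure bookkeeping;
* `Typed.Sec12A.htilde15ApproxFEe_of_afeWide` — the node in the `ε`-carrying reading on its full
  typed range `|t − 2πt₀| < 𝓛₁`, FROM the smoothed AFE on the range `|t − 2πt₀| < 𝓛₁ + 1` (stated
  inline = `Step11u024e` with `ell1 D + 1`): the shift `s ↦ s + β₆`, `β₆ = 3iα/2`, moves `t` by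
  `3α/2 ≤ 1`, so the tree's `Step11u024e`, typed on `|t − 2πt₀| < 𝓛₁` exactly, does not reach the
  edge of the node's range — that wide-range AFE is the one remaining input (every use of `𝓛₁` in the
  `Section11AFE*` engine has slack, e.g. `Section6Statements.InRange61` allows `𝓛₁ + 2`);
* `Typed.Sec12A.htilde15ApproxFEe_inner` — the node in the `ε`-carrying reading UNCONDITIONALLY on
  the inner range `|t − 2πt₀| < 𝓛₁ − 1`, from `Section11AFE.step11u024e_holds`.

Theorem-only; 0 new claims, 0 new facts; standard axioms.

## References

* Y. Zhang, arXiv:2211.02515v1 (2022), §12 p. 67 (tex L3426–L3429); §11 Lemma 11.2 p. 65; §4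
  (4.1)–(4.3). [cite: Zhang2022LandauSiegel, §12 p. 67]
-/

noncomputable section

open Complex Real ComplexConjugate MeasureTheory Set

namespace Literature.NumberTheory.LFunctions.Zhang2022.Section12Htilde15AFE

open Literature.NumberTheory.LFunctions.Zhang2022.Skeleton
open Literature.NumberTheory.LFunctions.Zhang2022.Typed.Sec12A
open Literature.NumberTheory.LFunctions.Zhang2022.GaussTails

variable {D : ℕ} [NeZero D] (χ : DirichletCharacter ℂ D) (x : Chr D)

/-! ## §4. The dual series: termwise integration and the sign `∫(g(P^{0.5}…) − g(P^z…)) = −∫(…)` -/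

omit [NeZero D] in
/-- Summability of the reflected terms `\overline{χψ}(n)n^{−(1−w)}g(P^zDt₀/n)` (`Re w = 1/2`,
`z ≤ 0.5`; majorant `Section11Deductions.norm_gTerm_le`). [cite: Zhang2022LandauSiegel, §11 p. 65] -/
theorem summable_gTerm (hD : 3 ≤ D) {w : ℂ} (hw : w.re = 1 / 2) {z : ℝ} (hz : z ≤ 0.5) :
    Summable fun n : ℕ =>
      conj (pc χ x n) * (n : ℂ) ^ (-(1 - w)) * (gW D (bigP D ^ z * (D : ℝ) * t0 D / (n : ℝ)) : ℂ) := by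
  have hM : Summable fun n : ℕ => 2 * (bigP D ^ (0.5 : ℝ) * D * t0 D) / (n : ℝ) ^ (3 / 2 : ℝ) := by
    have h := (Real.summable_one_div_nat_rpow.mpr (by norm_num : (1 : ℝ) < 3 / 2)).mul_left
      (2 * (bigP D ^ (0.5 : ℝ) * D * t0 D))
    refine h.congr fun n => ?_
    rw [mul_one_div]
  exact Summable.of_norm_bounded hM fun n => Section11Deductions.norm_gTerm_le χ x hD hw n hz

omit [NeZero D] in
/-- For a real (quadratic) `χ`: `conj(χψ(n)) = χ(n)ψ̄(n)`. [cite: Zhang2022LandauSiegel, §12 p. 67] -/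
theorem conj_pc_of_isQuadratic (hq : χ.IsQuadratic) (n : ℕ) :
    conj (pc χ x n) = χ (n : ZMod D) * conj (x.ψ (n : ZMod x.p)) := by
  rw [pc, map_mul, mul_comm]
  congr 1
  rcases hq (n : ZMod D) with h | h | h <;> simp [h]

omit [NeZero D] in
/-- **The dual term of the node, termwise**: for real `χ` and `w = s + β₆`,
`dualTerm(s,n) = −(∫_{0.496}^{0.5} \overline{χψ}(n)n^{−(1−w)}g(P^zDt₀/n)dz − 0.004·\overline{χψ}(n)n^{−(1−w)}g(P^{0.5}Dt₀/n))`.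
[cite: Zhang2022LandauSiegel, §12 p. 67, tex L3427–L3429] -/
theorem dualTerm_eq (hD : 2 ≤ D) (hq : χ.IsQuadratic) (s : ℂ) (n : ℕ) :
    dualTerm χ x s n =
      -((∫ z in (0.496 : ℝ)..0.5,
          conj (pc χ x n) * (n : ℂ) ^ (-(1 - (s + beta6 D))) *
            (gW D (bigP D ^ z * (D : ℝ) * t0 D / (n : ℝ)) : ℂ)) -
        ((0.004 : ℝ) : ℂ) * (conj (pc χ x n) * (n : ℂ) ^ (-(1 - (s + beta6 D))) *
            (gW D (bigP D ^ (0.5 : ℝ) * (D : ℝ) * t0 D / (n : ℝ)) : ℂ))) := by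
  -- the `z`-integral minus `0.004×` the constant is the integral of the difference
  have hcont := Section11Deductions.continuous_gTerm χ x hD (s + beta6 D) n
  have hconst : ((0.004 : ℝ) : ℂ) * (conj (pc χ x n) * (n : ℂ) ^ (-(1 - (s + beta6 D))) *
      (gW D (bigP D ^ (0.5 : ℝ) * (D : ℝ) * t0 D / (n : ℝ)) : ℂ)) =
      ∫ _z in (0.496 : ℝ)..0.5, conj (pc χ x n) * (n : ℂ) ^ (-(1 - (s + beta6 D))) *
        (gW D (bigP D ^ (0.5 : ℝ) * (D : ℝ) * t0 D / (n : ℝ)) : ℂ) := by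
    rw [intervalIntegral.integral_const, Complex.real_smul]
    norm_num
  rw [hconst, ← intervalIntegral.integral_sub (hcont.intervalIntegrable _ _) intervalIntegrable_const]
  have hterm : ∀ z : ℝ, conj (pc χ x n) * (n : ℂ) ^ (-(1 - (s + beta6 D))) *
        (gW D (bigP D ^ z * (D : ℝ) * t0 D / (n : ℝ)) : ℂ) -
      conj (pc χ x n) * (n : ℂ) ^ (-(1 - (s + beta6 D))) *
        (gW D (bigP D ^ (0.5 : ℝ) * (D : ℝ) * t0 D / (n : ℝ)) : ℂ) =
      conj (pc χ x n) * (n : ℂ) ^ (-(1 - (s + beta6 D))) *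
        ((gW D (bigP D ^ z * (D : ℝ) * t0 D / (n : ℝ)) -
          gW D (bigP D ^ (0.5 : ℝ) * (D : ℝ) * t0 D / (n : ℝ)) : ℝ) : ℂ) := by
    intro z; push_cast; ring
  simp_rw [hterm]
  rw [intervalIntegral.integral_const_mul, intervalIntegral.integral_ofReal, dualTerm,
    conj_pc_of_isQuadratic χ x hq, div_eq_mul_inv, ← Complex.cpow_neg,
    show (1 : ℂ) - s - beta6 D = 1 - (s + beta6 D) by ring]
  have hint : (∫ z in (0.496 : ℝ)..0.5,
      (gW D (bigP D ^ (0.5 : ℝ) * D * t0 D / n) - gW D (bigP D ^ z * D * t0 D / n))) =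
      -∫ z in (0.496 : ℝ)..0.5,
        (gW D (bigP D ^ z * (D : ℝ) * t0 D / (n : ℝ)) - gW D (bigP D ^ (0.5 : ℝ) * (D : ℝ) * t0 D / (n : ℝ))) := by
    rw [← intervalIntegral.integral_neg]
    congr 1
    funext z
    ring
  rw [hint]
  push_cast
  ring

omit [NeZero D] in
/-- **The dual series of the node is `−(∫_{0.496}^{0.5}G(z)dz − 0.004·G(0.5))`** for the reflected
series `G(z) = Σ_n \overline{χψ}(n)n^{−(1−s−β₆)}g(P^zDt₀/n)` (termwise integration, `χ` real).
[cite: Zhang2022LandauSiegel, §12 p. 67, tex L3427–L3429] -/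
theorem tsum_dualTerm_eq (hD : 3 ≤ D) (hq : χ.IsQuadratic) {s : ℂ} (hs : s.re = 1 / 2) :
    ∑' n : ℕ, dualTerm χ x s n =
      -((∫ z in (0.496 : ℝ)..0.5, ∑' n : ℕ, conj (pc χ x n) * (n : ℂ) ^ (-(1 - (s + beta6 D))) *
            (gW D (bigP D ^ z * (D : ℝ) * t0 D / (n : ℝ)) : ℂ)) -
        ((0.004 : ℝ) : ℂ) * ∑' n : ℕ, conj (pc χ x n) * (n : ℂ) ^ (-(1 - (s + beta6 D))) *
            (gW D (bigP D ^ (0.5 : ℝ) * (D : ℝ) * t0 D / (n : ℝ)) : ℂ)) := by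
  have hw : (s + beta6 D).re = 1 / 2 := by rw [add_beta6_re, hs]
  obtain ⟨h1, -⟩ := Section11Deductions.hasSum_gTerm χ x hD hw (a := 0.496) (b := 0.5) (by norm_num)
  have h2 := ((summable_gTerm χ x hD hw (z := 0.5) le_rfl).hasSum).mul_left (((0.004 : ℝ) : ℂ))
  have key := (h1.sub h2).neg
  have hfun : (fun n : ℕ => dualTerm χ x s n) = fun n : ℕ =>
      -((∫ z in (0.496 : ℝ)..0.5, conj (pc χ x n) * (n : ℂ) ^ (-(1 - (s + beta6 D))) *
            (gW D (bigP D ^ z * (D : ℝ) * t0 D / (n : ℝ)) : ℂ)) -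
        ((0.004 : ℝ) : ℂ) * (conj (pc χ x n) * (n : ℂ) ^ (-(1 - (s + beta6 D))) *
            (gW D (bigP D ^ (0.5 : ℝ) * (D : ℝ) * t0 D / (n : ℝ)) : ℂ))) := by
    funext n; exact dualTerm_eq χ x (by omega) hq s n
  rw [hfun]
  exact key.tsum_eq

/-! ## §5. The core: the approximate functional equation at `s + β₆` integrated over `[0.5, 0.504]` -/

/-- **The `H̃₁₅` display from the smoothed approximate functional equation at `s + β₆`.** For `ψ ∈ Ψ`,
`χ` real, `σ = 1/2`, `D ≥ ⌈e⁵⌉`: if for every `z ∈ [0.5, 0.504]` the smoothed AFE of Lemma 11.2 holds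
at `s + β₆` with error `≤ B` (the shape of `Section11AFE.Step11u024e`), then
`‖H̃₁₅(s,ψ) − (Z(s+β₆,ψχ)P₁^{β₆}/0.504)Σ_n dualTerm(s,n)‖ ≤ B + e^{−𝓛¹⁰/2}` — definition of `ϰ₁₂`,
Gaussian tails, `∫_{0.5}^{0.504}` of the AFE minus `0.004×` its instance `z = 0.5` (the two
`L(s+β₆,χψ)` cancel), `z ↦ 1 − z`, termwise integration on the dual side. The §12 p. 67 sentence
"Using the proof of Lemma 11.2 with `s + β₆` in place of `s`" made a kernel implication.
[cite: Zhang2022LandauSiegel, §12 p. 67, tex L3426–L3429] -/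
theorem htilde15_afe_core (hD5 : ⌈Real.exp 5⌉₊ ≤ D) (hD : 3 ≤ D) (hq : χ.IsQuadratic) {s : ℂ}
    (hs : s.re = 1 / 2) {B : ℝ}
    (hafe : ∀ z : ℝ, 0.5 ≤ z → z ≤ 0.504 →
      ‖(∑' n : ℕ, pc χ x n * (n : ℂ) ^ (-(s + beta6 D)) * (gW D (bigP D ^ z / (n : ℝ)) : ℂ)) -
          ((psiChi χ x).LFunction (s + beta6 D) -
            Zpc χ x (s + beta6 D) * ∑' n : ℕ, conj (pc χ x n) * (n : ℂ) ^ (-(1 - (s + beta6 D))) *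
              (gW D (bigP D ^ (1 - z) * (D : ℝ) * t0 D / (n : ℝ)) : ℂ))‖ ≤ B) :
    ‖Htilde15 χ x s - dualPrefactor χ x s * ∑' n : ℕ, dualTerm χ x s n‖ ≤
      B + Real.exp (-(1 / 2) * ell D ^ 10) := by
  have hD2 : 2 ≤ D := by omega
  set w : ℂ := s + beta6 D with hw_def
  have hw : w.re = 1 / 2 := by rw [hw_def, add_beta6_re, hs]
  have hB0 : 0 ≤ B := le_trans (norm_nonneg _) (hafe 0.5 (by norm_num) (by norm_num))
  -- the smoothed series `F(z)` and the reflected series `G(z)`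
  set F : ℝ → ℂ := fun z => ∑' n : ℕ, pc χ x n * (n : ℂ) ^ (-w) * (gW D (bigP D ^ z / (n : ℝ)) : ℂ)
    with hF_def
  set G : ℝ → ℂ := fun z => ∑' n : ℕ, conj (pc χ x n) * (n : ℂ) ^ (-(1 - w)) *
    (gW D (bigP D ^ z * (D : ℝ) * t0 D / (n : ℝ)) : ℂ) with hG_def
  set L := (psiChi χ x).LFunction w with hL_def
  set Z := Zpc χ x w with hZ_def
  set e : ℝ := Real.exp (-(1 / 2) * ell D ^ 10) with he_def
  set c4 : ℂ := ((0.004 : ℝ) : ℂ) with hc4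
  -- (1) `H̃₁₅` as an integral of the window sums
  have hH := Htilde15_eq_integral χ x hD2 s
  set W : Finset ℕ := (Finset.Ico 1 ⌈Skeleton.P1 D * etaPM D 1⌉₊).filter
    (fun n : ℕ => bigP D ^ (0.5 : ℝ) * etaPM D (-1) < n ∧ (n : ℝ) < Skeleton.P1 D * etaPM D 1) with hW
  set T : ℝ → ℕ → ℂ := fun z n => pc χ x n * (n : ℂ) ^ (-(s + beta6 D)) *
    ((gW D (bigP D ^ z / (n : ℝ)) - gW D (bigP D ^ (0.5 : ℝ) / (n : ℝ)) : ℝ) : ℂ) with hT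
  set SW := ∫ z in (0.5 : ℝ)..0.504, ∑ n ∈ W, T z n with hSW_def
  -- continuity / integrability of `F` on `[0.5, 0.504]`
  obtain ⟨-, hFcont⟩ := Section11Deductions.hasSum_fTerm χ x hD hw (a := 0.5) (b := 0.504) (by norm_num)
  have hFi : IntervalIntegrable F volume 0.5 0.504 :=
    (hFcont.mono (by rw [Set.uIcc_of_le (by norm_num)])).intervalIntegrable
  -- (2) window sums → `F(z) − F(0.5)`, error `0.004 · 2e`
  set IF := ∫ z in (0.5 : ℝ)..0.504, F z with hIF_def
  have hint2 : (∫ z in (0.5 : ℝ)..0.504, ((∑ n ∈ W, T z n) - (F z - F 0.5))) =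
      SW - (IF - c4 * F 0.5) := by
    have hWi : IntervalIntegrable (fun z : ℝ => ∑ n ∈ W, T z n) volume 0.5 0.504 := by
      refine (continuous_finsetSum _ fun n _ => ?_).intervalIntegrable _ _
      simp only [hT]
      exact continuous_dTerm χ x hD2 s n
    rw [intervalIntegral.integral_sub hWi (hFi.sub intervalIntegrable_const),
      intervalIntegral.integral_sub hFi intervalIntegrable_const, intervalIntegral.integral_const,
      Complex.real_smul]
    have e4 : ((0.504 - 0.5 : ℝ) : ℂ) = ((0.004 : ℝ) : ℂ) := by norm_num
    rw [e4]
  have h2 : ‖SW - (IF - c4 * F 0.5)‖ ≤ 2 * e * |0.504 - 0.5| := by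
    rw [← hint2]
    refine intervalIntegral.norm_integral_le_of_norm_le_const fun z hz => ?_
    rw [Set.uIoc_of_le (by norm_num), Set.mem_Ioc] at hz
    have hsub : F z - F 0.5 = ∑' n : ℕ, T z n := tsum_sub_eq_tsum_dTerm χ x hD hs hz.2
    rw [hsub]
    simp only [hT]
    exact norm_winSum_sub_tsum_le χ x hD5 hD hs hz.1.le hz.2
  -- (3) the AFE integrated over `[0.5, 0.504]`
  set IG := ∫ z in (0.496 : ℝ)..0.5, G z with hIG_def
  have h3 : ‖IF - (c4 * L - Z * IG)‖ ≤ B * 0.004 := by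
    have k := Section11LeavesEps.integral_afe_le' χ x hD hw (B := B) (a := 0.5) (b := 0.504)
      (by norm_num) (by norm_num) (by norm_num) hafe
    have e1 : ((0.504 - 0.5 : ℝ) : ℂ) = ((0.004 : ℝ) : ℂ) := by norm_num
    have e2 : (1 : ℝ) - 0.504 = 0.496 := by norm_num
    have e3 : (1 : ℝ) - 0.5 = 0.5 := by norm_num
    have e4 : (0.504 - 0.5 : ℝ) = 0.004 := by norm_num
    rw [e1, e2, e3, e4] at k
    exact k
  -- (4) the AFE at `z = 0.5`
  have h4 : ‖F 0.5 - (L - Z * G 0.5)‖ ≤ B := by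
    have k := hafe 0.5 (by norm_num) (by norm_num)
    have e3 : (1 : ℝ) - 0.5 = 0.5 := by norm_num
    rw [e3] at k
    exact k
  -- (5) the dual series
  have h5 : ∑' n : ℕ, dualTerm χ x s n = -(IG - c4 * G 0.5) := tsum_dualTerm_eq χ x hD hq hs
  -- (6) algebra
  have hc0 : ((1 / 0.504 : ℝ) : ℂ) = 1 / ((0.504 : ℝ) : ℂ) := by push_cast; ring
  have key : Htilde15 χ x s - dualPrefactor χ x s * ∑' n : ℕ, dualTerm χ x s n =
      ((1 / 0.504 : ℝ) : ℂ) * ((Skeleton.P1 D : ℂ) ^ beta6 D) *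
        ((SW - (IF - c4 * F 0.5)) + (IF - (c4 * L - Z * IG)) - c4 * (F 0.5 - (L - Z * G 0.5))) := by
    rw [hH, h5, dualPrefactor, hc0]
    field_simp
    ring
  have hnormc : ‖((1 / 0.504 : ℝ) : ℂ) * ((Skeleton.P1 D : ℂ) ^ beta6 D)‖ = 1 / 0.504 := by
    rw [norm_mul, norm_cpow_beta6 (P1_pos D), mul_one, Complex.norm_real, Real.norm_eq_abs,
      abs_of_pos (by norm_num)]
  have hc4n : ‖c4‖ = 0.004 := by
    rw [hc4, Complex.norm_real, Real.norm_eq_abs, abs_of_pos (by norm_num)]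
  rw [key, norm_mul, hnormc]
  have htri : ‖(SW - (IF - c4 * F 0.5)) + (IF - (c4 * L - Z * IG)) - c4 * (F 0.5 - (L - Z * G 0.5))‖ ≤
      2 * e * |0.504 - 0.5| + B * 0.004 + 0.004 * B := by
    calc ‖(SW - (IF - c4 * F 0.5)) + (IF - (c4 * L - Z * IG)) - c4 * (F 0.5 - (L - Z * G 0.5))‖
        ≤ ‖(SW - (IF - c4 * F 0.5)) + (IF - (c4 * L - Z * IG))‖ + ‖c4 * (F 0.5 - (L - Z * G 0.5))‖ :=
          norm_sub_le _ _
      _ ≤ (‖SW - (IF - c4 * F 0.5)‖ + ‖IF - (c4 * L - Z * IG)‖) + ‖c4‖ * ‖F 0.5 - (L - Z * G 0.5)‖ := by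
          gcongr
          · exact norm_add_le _ _
          · exact (norm_mul_le _ _)
      _ ≤ (2 * e * |0.504 - 0.5| + B * 0.004) + 0.004 * B := by
          rw [hc4n]; gcongr
  have habs : |(0.504 : ℝ) - 0.5| = 0.004 := by norm_num
  rw [habs] at htri
  have he0 : 0 < e := Real.exp_pos _
  calc 1 / 0.504 * ‖(SW - (IF - c4 * F 0.5)) + (IF - (c4 * L - Z * IG)) - c4 * (F 0.5 - (L - Z * G 0.5))‖
      ≤ 1 / 0.504 * (2 * e * 0.004 + B * 0.004 + 0.004 * B) := by gcongr
    _ ≤ B + e := by nlinarith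

/-! ## §6. The node `Z22:§12.u009` in the `ε`-carrying reading -/

/-- **`Typed.Sec12A.Htilde15ApproxFE` in the `ε`-carrying reading, on its full typed range, FROM the
smoothed approximate functional equation of Lemma 11.2 on the range `|t − 2πt₀| < 𝓛₁ + 1`** (the
hypothesis is `Section11AFE.Step11u024e` with `ell1 D + 1` in place of `ell1 D`, stated inline):
for `ψ ∈ Ψ`, `σ = 1/2`, `|t − 2πt₀| < 𝓛₁`, under (A), `D` large,
`‖H̃₁₅(s,ψ) − (Z(s+β₆,ψχ)P₁^{β₆}/0.504)Σ_n dualTerm(s,n)‖ ≤ C·(E₂(s+β₆,ψ) + e^{−c𝓛¹⁰})`. The shift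
`s ↦ s + β₆` (`β₆ = 3iα/2`) moves `t` by `3α/2 ≤ 1`, which is why the AFE is needed slightly beyond
the range on which the tree's `step11u024e_holds` is typed. [cite: Zhang2022LandauSiegel, §12 p. 67] -/
theorem _root_.Literature.NumberTheory.LFunctions.Zhang2022.Typed.Sec12A.htilde15ApproxFEe_of_afeWide
    (hafe : ∃ c : ℝ, 0 < c ∧ ∃ C : ℝ, ForAllLarge fun D _ χ => AssumptionA D χ → ∀ x : Chr D, ∀ s : ℂ,
      s.re = 1 / 2 → |s.im - 2 * π * t0 D| < ell1 D + 1 → ∀ z : ℝ, 0.5 ≤ z → z ≤ 0.504 →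
        ‖(∑' n : ℕ, pc χ x n * (n : ℂ) ^ (-s) * (gW D (bigP D ^ z / (n : ℝ)) : ℂ)) -
            ((psiChi χ x).LFunction s -
              Zpc χ x s * ∑' n : ℕ, conj (pc χ x n) * (n : ℂ) ^ (-(1 - s)) *
                (gW D (bigP D ^ (1 - z) * (D : ℝ) * t0 D / (n : ℝ)) : ℂ))‖
          ≤ C * (E2main χ x s + Real.exp (-c * ell D ^ 10))) :
    ∃ c : ℝ, 0 < c ∧ ∃ C : ℝ, ForAllLarge fun D _ χ => AssumptionA D χ → ∀ x : Chr D, ∀ s : ℂ,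
      s.re = 1 / 2 → |s.im - 2 * π * t0 D| < ell1 D →
        ‖Htilde15 χ x s - dualPrefactor χ x s * ∑' n : ℕ, dualTerm χ x s n‖ ≤
          C * (E2main χ x (s + beta6 D) + Real.exp (-c * ell D ^ 10)) := by
  obtain ⟨c, hc, C, D₀, h⟩ := hafe
  refine ⟨min c (1 / 2), lt_min hc (by norm_num), |C| + 1, max D₀ (max ⌈Real.exp 5⌉₊ 9),
    fun D _ χ hD hq hp hA x s hs ht => ?_⟩
  have hD₀ : D₀ ≤ D := le_trans (le_max_left _ _) hD
  have hD5 : ⌈Real.exp 5⌉₊ ≤ D := le_trans (le_trans (le_max_left _ _) (le_max_right _ _)) hD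
  have hD9 : 9 ≤ D := le_trans (le_trans (le_max_right _ _) (le_max_right _ _)) hD
  have hD3 : 3 ≤ D := by omega
  have hL5 : 5 ≤ ell D := five_le_ell hD5
  obtain ⟨hα, hα0⟩ := three_halves_alpha_le_one (D := D) (by linarith)
  -- the range of `s + β₆`
  have hs' : (s + beta6 D).re = 1 / 2 := by rw [add_beta6_re, hs]
  have ht' : |(s + beta6 D).im - 2 * π * t0 D| < ell1 D + 1 := by
    rw [add_beta6_im]
    have := abs_sub_lt_iff.mp ht
    rw [abs_sub_lt_iff]
    constructor <;> nlinarith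
  have hB := fun z hz1 hz2 => h D χ hD₀ hq hp hA x (s + beta6 D) hs' ht' z hz1 hz2
  have hcore := htilde15_afe_core χ x hD5 hD3 hq hs hB
  refine hcore.trans ?_
  have hE : 0 ≤ E2main χ x (s + beta6 D) := Section11AFE.E2main_nonneg χ x _
  have hL0 : 0 ≤ ell D ^ 10 := by positivity
  have hec : Real.exp (-c * ell D ^ 10) ≤ Real.exp (-min c (1 / 2) * ell D ^ 10) :=
    Real.exp_le_exp.mpr (by nlinarith [min_le_left c (1 / 2)])
  have he2 : Real.exp (-(1 / 2) * ell D ^ 10) ≤ Real.exp (-min c (1 / 2) * ell D ^ 10) :=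
    Real.exp_le_exp.mpr (by nlinarith [min_le_right c (1 / 2)])
  have hsum0 : 0 ≤ E2main χ x (s + beta6 D) + Real.exp (-c * ell D ^ 10) := by
    have := Real.exp_pos (-c * ell D ^ 10); linarith
  have h1 : C * (E2main χ x (s + beta6 D) + Real.exp (-c * ell D ^ 10)) ≤
      |C| * (E2main χ x (s + beta6 D) + Real.exp (-c * ell D ^ 10)) :=
    mul_le_mul_of_nonneg_right (le_abs_self C) hsum0
  have h2 : |C| * (E2main χ x (s + beta6 D) + Real.exp (-c * ell D ^ 10)) ≤
      |C| * (E2main χ x (s + beta6 D) + Real.exp (-min c (1 / 2) * ell D ^ 10)) :=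
    mul_le_mul_of_nonneg_left (by linarith) (abs_nonneg C)
  have h3 : (|C| + 1) * (E2main χ x (s + beta6 D) + Real.exp (-min c (1 / 2) * ell D ^ 10)) =
      |C| * (E2main χ x (s + beta6 D) + Real.exp (-min c (1 / 2) * ell D ^ 10)) +
        (E2main χ x (s + beta6 D) + Real.exp (-min c (1 / 2) * ell D ^ 10)) := by ring
  rw [h3]
  linarith

/-- **`Typed.Sec12A.Htilde15ApproxFE` in the `ε`-carrying reading holds UNCONDITIONALLY on the inner
range `|t − 2πt₀| < 𝓛₁ − 1`** (there `s + β₆` lies in the typed range of the tree's PROVED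
`Section11AFE.step11u024e_holds`, since `3α/2 ≤ 1`): for `ψ ∈ Ψ`, `σ = 1/2`, `|t − 2πt₀| < 𝓛₁ − 1`,
under (A), `D` large, `‖H̃₁₅(s,ψ) − (Z(s+β₆,ψχ)P₁^{β₆}/0.504)Σ_n dualTerm(s,n)‖ ≤
C·(E₂(s+β₆,ψ) + e^{−c𝓛¹⁰})`. [cite: Zhang2022LandauSiegel, §12 p. 67; §11 Lemma 11.2] -/
theorem _root_.Literature.NumberTheory.LFunctions.Zhang2022.Typed.Sec12A.htilde15ApproxFEe_inner :
    ∃ c : ℝ, 0 < c ∧ ∃ C : ℝ, ForAllLarge fun D _ χ => AssumptionA D χ → ∀ x : Chr D, ∀ s : ℂ,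
      s.re = 1 / 2 → |s.im - 2 * π * t0 D| < ell1 D - 1 →
        ‖Htilde15 χ x s - dualPrefactor χ x s * ∑' n : ℕ, dualTerm χ x s n‖ ≤
          C * (E2main χ x (s + beta6 D) + Real.exp (-c * ell D ^ 10)) := by
  obtain ⟨c, hc, C, D₀, h⟩ := Section11AFE.step11u024e_holds
  refine ⟨min c (1 / 2), lt_min hc (by norm_num), |C| + 1, max D₀ (max ⌈Real.exp 5⌉₊ 9),
    fun D _ χ hD hq hp hA x s hs ht => ?_⟩
  have hD₀ : D₀ ≤ D := le_trans (le_max_left _ _) hD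
  have hD5 : ⌈Real.exp 5⌉₊ ≤ D := le_trans (le_trans (le_max_left _ _) (le_max_right _ _)) hD
  have hD9 : 9 ≤ D := le_trans (le_trans (le_max_right _ _) (le_max_right _ _)) hD
  have hD3 : 3 ≤ D := by omega
  have hL5 : 5 ≤ ell D := five_le_ell hD5
  obtain ⟨hα, hα0⟩ := three_halves_alpha_le_one (D := D) (by linarith)
  have hs' : (s + beta6 D).re = 1 / 2 := by rw [add_beta6_re, hs]
  have ht' : |(s + beta6 D).im - 2 * π * t0 D| < ell1 D := by
    rw [add_beta6_im]
    have := abs_sub_lt_iff.mp ht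
    rw [abs_sub_lt_iff]
    constructor <;> nlinarith
  have hB := fun z hz1 hz2 => h D χ hD₀ hq hp hA x (s + beta6 D) hs' ht' z hz1 hz2
  have hcore := htilde15_afe_core χ x hD5 hD3 hq hs hB
  refine hcore.trans ?_
  have hE : 0 ≤ E2main χ x (s + beta6 D) := Section11AFE.E2main_nonneg χ x _
  have hL0 : 0 ≤ ell D ^ 10 := by positivity
  have hec : Real.exp (-c * ell D ^ 10) ≤ Real.exp (-min c (1 / 2) * ell D ^ 10) :=
    Real.exp_le_exp.mpr (by nlinarith [min_le_left c (1 / 2)])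
  have he2 : Real.exp (-(1 / 2) * ell D ^ 10) ≤ Real.exp (-min c (1 / 2) * ell D ^ 10) :=
    Real.exp_le_exp.mpr (by nlinarith [min_le_right c (1 / 2)])
  have hsum0 : 0 ≤ E2main χ x (s + beta6 D) + Real.exp (-c * ell D ^ 10) := by
    have := Real.exp_pos (-c * ell D ^ 10); linarith
  have h1 : C * (E2main χ x (s + beta6 D) + Real.exp (-c * ell D ^ 10)) ≤
      |C| * (E2main χ x (s + beta6 D) + Real.exp (-c * ell D ^ 10)) :=
    mul_le_mul_of_nonneg_right (le_abs_self C) hsum0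
  have h2 : |C| * (E2main χ x (s + beta6 D) + Real.exp (-c * ell D ^ 10)) ≤
      |C| * (E2main χ x (s + beta6 D) + Real.exp (-min c (1 / 2) * ell D ^ 10)) :=
    mul_le_mul_of_nonneg_left (by linarith) (abs_nonneg C)
  have h3 : (|C| + 1) * (E2main χ x (s + beta6 D) + Real.exp (-min c (1 / 2) * ell D ^ 10)) =
      |C| * (E2main χ x (s + beta6 D) + Real.exp (-min c (1 / 2) * ell D ^ 10)) +
        (E2main χ x (s + beta6 D) + Real.exp (-min c (1 / 2) * ell D ^ 10)) := by ring
  rw [h3]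
  linarith

end Literature.NumberTheory.LFunctions.Zhang2022.Section12Htilde15AFE
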